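import Summits.HodgeConjecture.HodgeConjecture.Theorems.F0P3cStCharTSWeylHypJacobianSocket   -- ★ p852119 (LH6-p04 g6) (J6) FILE 6 «SOCKET»: `tubeJacobianSocket_vanDijkWeight_sq` (the Φ-free `hJacLoc`, unconditional); brings ★ FILE 5 p852079, ★ ADAPTER-M, ★ (J6-pre) `…WeylHypWIFJacLocal`
import HarnessLib

/-!
# F0 · P3c · line LH6 «StCharTS» — ROAD «JAC-LOC» TERMINUS «(WIF) DENSITY ON THE HYPERBOLIC SET — UNCONDITIONAL»: Rogawski's Weyl integration formula for `U(Φ₃)(L⁺_v)` on the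
# hyperbolic set `Ω`, in density form, with van Dijk's weight `(Re Δ)² = D_G²` and NO socket hypothesis (Rogawski 1990 §12.5 p. 182; Harish-Chandra 1970 Lemmas 22 ∕ 42)

Cell `pub/hodgecm-mathlib`, crux H413 = `stmt-HodgeConjecture-24833` (lane `--supports … --as helper`); seat LH6-p03 (g6), HOLDER of the road «JAC-LOC» (heir of g5): the road's
closing line.  THEOREMS ONLY; no definition ∕ instance ∕ notation ∕ named fact ∕ `sorry`; ★-only imports.  HONEST LABEL: count-neutral; closes no organ by itself — with ★ (J6)
FILE 7 `…WeylHypJacobianCartanM` (the `hJac i` slot of ★ (E4) at the split Cartan) it removes the split-Cartan tube Jacobian from the inputs of the print residue «WIF» of the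
(S-𝔇) organ `stub_EllipticPackage`; the compact Cartans are road «JAC-ELL».  HC_CM is proved only modulo the 7 printed citations (2 remaining: hLiu418 =
`stmt-HodgeConjecture-24832`, h413 = `stmt-HodgeConjecture-24833`) until rung 0 closes.

THE ROAD (all ★): (J0) p851645 socket `hJacLoc` ⇒ weighted WIF on `Ω` · (J1) p851761∕p851817 tube-σ + coset reduction · (J2) p851741∕p851782 level boxes · (J3)∕(J3⁻) p851676∕p851699
van Dijk boxes · (J4a∕b∕c) abelian sandwich ∕ its measure ∕ ORBIT ⊆ · (J5a∕b∕c, J5-ARITH) closure, Newton step, ORBIT ⊇, level schedule · ORBIT-TUBE-EQ p851886 · (J6.5) p851860 ·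
(J6-T) p851879 · (J6-M) p851901 · (T5) p851908 · (J6-W) p851981 · (J7) p851690 · SHIFT-LC ∕ (J6-D) `…RootUnitLocConst` ∕ `…WeightLocConst` · (T4) p852043 · (J6) FILES 1–7
p851888 p851953 p851969 p852061 p852079 p852119 p852138 · ADAPTER-M p851891 · (J6-pre) `…WeylHypWIFJacLocal` (the density formula CONDITIONAL on `hJacLoc`).
THIS FILE: **`integral_mul_eq_integral_classOrbitalIntegral_density_vanDijkWeight_sq`** — ★ (J6-pre)'s statement (= ★ p849989's with the LOCAL socket) with its only road hypothesis
`hJacLoc` DISCHARGED by ★ FILE 6: for every measurable `D : M → ℝ≥0` with `(D t : ℝ) = (Re Δ(t))²`, every measurable locally `ν`-integrable `α` conjugation-invariant on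
`hyperbolicSet L v`, every `φ` with `IsLocSmooth φ` and `tsupport φ ⊆ hyperbolicSet L v`:
`∫ φ·α dν = ∫ classOrbitalIntegral mQv φ ⟦ι m⟧ · (ρ m · α(ι m)) dμM(m)`, `ρ m = (2 · ((ι_*μM)(compactCore M)).toReal)⁻¹ · D(ι m)` (`ι = torusChart L v`).

## References
* [Rogawski1990] J. D. Rogawski, *Automorphic Representations of Unitary Groups in Three Variables*, Ann. of Math. Stud. 123 (1990), §12.5 p. 182; §12.7 L. 12.7.2 (proof) p. 193.
* [HarishChandra1970] Harish-Chandra (notes by G. van Dijk), *Harmonic analysis on reductive p-adic groups*, LNM 162 (1970), Lemma 22, Lemma 42.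
* [DeitmarEchterhoff2014] A. Deitmar, S. Echterhoff, *Principles of Harmonic Analysis*, 2nd ed. (2014), Thm. 1.5.3.
-/

set_option autoImplicit false
-- the mandated namespace has the single-problem summit's repeated segment (`HodgeConjecture.HodgeConjecture`)
set_option linter.dupNamespace false

noncomputable section

open MeasureTheory Measure Set Filter Topology Function NumberField IsDedekindDomain Matrix
open Literature.MeasureTheory.Group
open Literature.NumberTheory.Automorphic Literature.NumberTheory.Automorphic.UnitaryGroup Literature.NumberTheory.Rogawski1990
open Summit.HodgeConjecture.HodgeConjecture.Cruxes.H413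
open Summit.HodgeConjecture.HodgeConjecture.Cruxes.H413.F0P3cStCharTSWeylHypMeasure
open Summit.HodgeConjecture.HodgeConjecture.Cruxes.H413.F0P3cStCharTSWeylHypCM
open Summit.HodgeConjecture.HodgeConjecture.Cruxes.H413.F0P3cStCharTSWeylHypTorsor
open Summit.HodgeConjecture.HodgeConjecture.Cruxes.H413.F0P3cStCharTSWeylHypJacobianSocket
open Summit.HodgeConjecture.HodgeConjecture.Cruxes.H413.F0P3cStCharTSWeylHypWIFJacLocal
open Summit.HodgeConjecture.HodgeConjecture.Cruxes.H413.F0P3cStCharTSTorusDefs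
open scoped ENNReal NNReal MatrixGroups Pointwise

namespace Summit.HodgeConjecture.HodgeConjecture.Cruxes.H413.F0P3cStCharTSWeylHypWIFDensity

section CM

variable (L : Type) [Field L] [NumberField L] [IsCMField L] (v : HeightOneSpectrum (𝓞 ↥(maximalRealSubfield L)))

/-! ## The Weyl integration formula on the hyperbolic set in density form, `hJacLoc` discharged -/

set_option maxHeartbeats 1600000 in
set_option synthInstance.maxHeartbeats 200000 in
-- as ★ (J6-pre)
/-- **«(WIF) DENSITY ON THE HYPERBOLIC SET», UNCONDITIONAL** — ★ (J6-pre) `integral_mul_eq_integral_classOrbitalIntegral_density_of_tubeJacobian_local` (★ p849989's statement with the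
LOCAL socket) with its only road hypothesis `hJacLoc` DISCHARGED by ★ (J6) FILE 6 `tubeJacobianSocket_vanDijkWeight_sq`: for every measurable `D : M → ℝ≥0` with `(D t : ℝ) = (Re Δ(t))²`, every measurable locally integrable `α`
conjugation-invariant on `hyperbolicSet L v`, and every `φ` with `IsLocSmooth φ`, `tsupport φ ⊆ hyperbolicSet L v`:
`∫ φ·α dν = ∫_M classOrbitalIntegral mQv φ ⟦ι m⟧ · (ρ m · α(ι m)) dμM`, `ρ m = (2 · ((ι_*μM)(compactCore M)).toReal)⁻¹ · D(ι m)` — the hyperbolic half of the Weyl integration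
formula of `U(Φ₃)(L⁺_v)` [Rogawski1990 §12.5 p. 182], proved in-house along the road (J0)–(J7), (T4), (J6) FILES 1–5.
[cite: Rogawski1990, §12.5 p. 182; §12.7 L. 12.7.2 (proof) p. 193] [cite: HarishChandra1970, Lemma 22; Lemma 42] -/
theorem integral_mul_eq_integral_classOrbitalIntegral_density_vanDijkWeight_sq
    (hns : ∀ w : PlacesOver L v, IsCMField.complexConj L • w.1 = w.1)
    [MeasurableSpace ↥(unitaryGroupOfForm (conjLocal L (IsCMField.complexConj L) v) (cmLocalForm L 3 v))] [BorelSpace ↥(unitaryGroupOfForm (conjLocal L (IsCMField.complexConj L) v) (cmLocalForm L 3 v))] [LocallyCompactSpace ↥(unitaryGroupOfForm (conjLocal L (IsCMField.complexConj L) v) (cmLocalForm L 3 v))] [SecondCountableTopology ↥(unitaryGroupOfForm (conjLocal L (IsCMField.complexConj L) v) (cmLocalForm L 3 v))] [T2Space ↥(unitaryGroupOfForm (conjLocal L (IsCMField.complexConj L) v) (cmLocalForm L 3 v))]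
    [∀ γ : ↥(unitaryGroupOfForm (conjLocal L (IsCMField.complexConj L) v) (cmLocalForm L 3 v)), MeasurableSpace (↥(unitaryGroupOfForm (conjLocal L (IsCMField.complexConj L) v) (cmLocalForm L 3 v)) ⧸ Subgroup.centralizer ({γ} : Set ↥(unitaryGroupOfForm (conjLocal L (IsCMField.complexConj L) v) (cmLocalForm L 3 v))))] [∀ γ : ↥(unitaryGroupOfForm (conjLocal L (IsCMField.complexConj L) v) (cmLocalForm L 3 v)), BorelSpace (↥(unitaryGroupOfForm (conjLocal L (IsCMField.complexConj L) v) (cmLocalForm L 3 v)) ⧸ Subgroup.centralizer ({γ} : Set ↥(unitaryGroupOfForm (conjLocal L (IsCMField.complexConj L) v) (cmLocalForm L 3 v))))]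
    [MeasurableSpace ((LocalRing L v)ˣ × ↥(normOneUnits (conjLocal L (IsCMField.complexConj L) v)))] [BorelSpace ((LocalRing L v)ˣ × ↥(normOneUnits (conjLocal L (IsCMField.complexConj L) v)))]
    (ν : Measure ↥(unitaryGroupOfForm (conjLocal L (IsCMField.complexConj L) v) (cmLocalForm L 3 v))) [ν.IsHaarMeasure] [ν.IsMulRightInvariant]
    {mQv : OrbitalMeasureFamily ↥(unitaryGroupOfForm (conjLocal L (IsCMField.complexConj L) v) (cmLocalForm L 3 v))} (hcanQ : mQv.IsCanonical (fun γ => IsRegularElt (γ.val : GL (Fin 3) (LocalRing L v))) ν)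
    (μM : Measure ((LocalRing L v)ˣ × ↥(normOneUnits (conjLocal L (IsCMField.complexConj L) v)))) [μM.IsHaarMeasure]
    (w : ↥(unitaryGroupOfForm (conjLocal L (IsCMField.complexConj L) v) (cmLocalForm L 3 v))) (hw : Units.val (w : GL (Fin 3) (LocalRing L v)) = cmLocalForm L 3 v)
    (D : ↥(cmBorelTriple L 3 v).M → ℝ≥0) (hD : Measurable D)
    (hDsq : ∀ t : ↥(cmBorelTriple L 3 v).M, (D t : ℝ) = ((F0P3cStCharTSTorusDefs.vanDijkWeight L v t).re) ^ 2) :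
    ∀ α : ↥(unitaryGroupOfForm (conjLocal L (IsCMField.complexConj L) v) (cmLocalForm L 3 v)) → ℂ, Measurable α → LocallyIntegrable α ν →
      (∀ x : ↥(unitaryGroupOfForm (conjLocal L (IsCMField.complexConj L) v) (cmLocalForm L 3 v)), x ∈ (hyperbolicSet L v : Set ↥(unitaryGroupOfForm (conjLocal L (IsCMField.complexConj L) v) (cmLocalForm L 3 v))) → ∀ h : ↥(unitaryGroupOfForm (conjLocal L (IsCMField.complexConj L) v) (cmLocalForm L 3 v)), α (h * x * h⁻¹) = α x) →
      ∀ φ : ↥(unitaryGroupOfForm (conjLocal L (IsCMField.complexConj L) v) (cmLocalForm L 3 v)) → ℂ, IsLocSmooth φ → tsupport φ ⊆ (hyperbolicSet L v : Set ↥(unitaryGroupOfForm (conjLocal L (IsCMField.complexConj L) v) (cmLocalForm L 3 v))) →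
        ∫ x, φ x * α x ∂ν =
          ∫ m, classOrbitalIntegral mQv φ (ConjClasses.mk (((torusChart L v m : ↥(cmBorelTriple L 3 v).M) : ↥(unitaryGroupOfForm (conjLocal L (IsCMField.complexConj L) v) (cmLocalForm L 3 v))))) *
            ((((2 * ((μM.map (torusChart L v)) (compactCore ↥(cmBorelTriple L 3 v).M)).toReal)⁻¹ * (D (torusChart L v m) : ℝ) : ℝ) : ℂ) *
              α ((torusChart L v m : ↥(cmBorelTriple L 3 v).M) : ↥(unitaryGroupOfForm (conjLocal L (IsCMField.complexConj L) v) (cmLocalForm L 3 v)))) ∂μM := by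
  intro α hαm hαli hαinv φ hφ hsupp
  exact integral_mul_eq_integral_classOrbitalIntegral_density_of_tubeJacobian_local L v hns ν hcanQ μM w hw D hD
    (tubeJacobianSocket_vanDijkWeight_sq L v hns ν w hw D hDsq) α hαm hαli hαinv φ hφ hsupp

end CM

end Summit.HodgeConjecture.HodgeConjecture.Cruxes.H413.F0P3cStCharTSWeylHypWIFDensity

end
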